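import Summits.HodgeConjecture.HodgeConjecture.Theorems.K2E3UnipotentRadicalLimitCompactOpen
import Summits.HodgeConjecture.HodgeConjecture.Theorems.K2E3UnitaryParabolicTopology
import HarnessLib

/-!
# K2 ∕ E3 «EllipticInputs», 13a road A, J4 (ii)-top (continued): `IsLimitOfCompactOpen` passes to `K ∩ M` for `M` closed — the radicals
# `N_S ∩ M_{S'}` of the LEVI TRIPLES of a local unitary group are limits of compact open subgroups (the DRIVER's `hsNl`)

Cell `hodgecm-mathlib` (Track B «K2-LIT»), item h413 = `stmt-HodgeConjecture-24833`; author K2E3-p10 (g2); count-neutral helper for the 13a line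
(road A; DRIVER ★ `K2E3LocalIrrepAdmissibleOfConeInputs`, binder `hsNl : ∀ i j, j < i → IsLimitOfCompactOpen ↥(s i j).N` for the Levi triples
`s i j` = K2-defs1's `leviTriple`, whose `N` is `((unipotentRadicalGL _ (wittBlockOn e S)).comap U.subtype).subgroupOf (wittLevi … S')`).
PROOF lane: theorems only (no `def`, no `instance`, no `sorry`).

* §1 **`isLimitOfCompactOpen_subgroupOf`** — for subgroups `K, M` of a topological group with `M` closed: if `↥K` is a limit of compact open
  subgroups then so is `↥(K.subgroupOf M)` (= `K ∩ M` seen in `↥M`; closed embedding into `↥K`, ★ `IsLimitOfCompactOpen.of_isClosedEmbedding`);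
  `isLimitOfCompactOpen_of_eq_subgroupOf` — the same for any `S' = K.subgroupOf M` (the shape of a structure field).
* §2 **`isLimitOfCompactOpen_subgroupOf_comap_unipotentRadicalGL_local`** — at a finite place `v` of a quadratic extension `E/F`, for ANY form `J'` over
  `E_v` and ANY two labellings `b, b'`: `((U_b(E_v)).comap U.subtype).subgroupOf ((M_{b'}(E_v)).comap U.subtype)` is a limit of compact open subgroups
  (★ p855692 + §1 + ★ `isClosed_comap_standardLeviGL`).

References: I. N. Bernstein, A. V. Zelevinsky (1977), §1.9, §2.3; W. Casselman (1995), Prop. 1.4.4.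
-/

set_option autoImplicit false
set_option linter.dupNamespace false

noncomputable section

namespace Summit.HodgeConjecture.HodgeConjecture.Cruxes.H413.K2E3LimitCompactOpenSubgroupOf

open NumberField IsDedekindDomain
open _root_.Topology
open Literature.NumberTheory.Automorphic Literature.NumberTheory.Automorphic.UnitaryGroup
open K2E3UnipotentRadicalLimitCompactOpen K2E3UnitaryParabolicTopology
open scoped Matrix MatrixGroups

/-! ## §1 `K ∩ M` inside `↥M` -/

section Generic

variable {G : Type*} [Group G] [TopologicalSpace G]

/-- **`IsLimitOfCompactOpen` passes from `K` to `K ∩ M` (as the subgroup `K.subgroupOf M` of `↥M`) when `M` is closed**: the inclusion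
`↥(K.subgroupOf M) → ↥K` is a closed embedding (its range is the preimage of the closed `M`). [cite: BernsteinZelevinsky1977, §1.9] -/
theorem isLimitOfCompactOpen_subgroupOf {K M : Subgroup G} (hK : IsLimitOfCompactOpen ↥K) (hM : IsClosed (M : Set G)) :
    IsLimitOfCompactOpen ↥(K.subgroupOf M) := by
  -- the inclusion homomorphism
  let φ : ↥(K.subgroupOf M) →* ↥K :=
    (M.subtype.comp (K.subgroupOf M).subtype).codRestrict K fun x => Subgroup.mem_subgroupOf.1 x.2
  have hφval : ∀ x, ((φ x : ↥K) : G) = ((x : ↥M) : G) := fun _ => rfl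
  have hcont : Continuous φ :=
    Continuous.subtype_mk (continuous_subtype_val.comp continuous_subtype_val) _
  -- embedding: `K.subtype ∘ φ = M.subtype ∘ (K.subgroupOf M).subtype` is an embedding
  have hcomp : IsEmbedding (fun x : ↥(K.subgroupOf M) => ((φ x : ↥K) : G)) := by
    simp only [hφval]
    exact IsEmbedding.subtypeVal.comp IsEmbedding.subtypeVal
  have hemb : IsEmbedding φ := IsEmbedding.of_comp hcont continuous_subtype_val hcomp
  -- closed range: `{k : K | (k : G) ∈ M}`
  have hrange : Set.range φ = ((↑) : ↥K → G) ⁻¹' (M : Set G) := by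
    ext k
    constructor
    · rintro ⟨x, rfl⟩
      exact (x : ↥M).2
    · intro hk
      exact ⟨⟨⟨(k : G), hk⟩, Subgroup.mem_subgroupOf.2 k.2⟩, Subtype.ext rfl⟩
  have hclosed : IsClosedEmbedding φ := ⟨hemb, by rw [hrange]; exact hM.preimage continuous_subtype_val⟩
  exact IsLimitOfCompactOpen.of_isClosedEmbedding φ hclosed hK

/-- The same for any subgroup `S'` of `↥M` that EQUALS `K.subgroupOf M` (the shape in which a structure field `s.N` is given).
[cite: BernsteinZelevinsky1977, §1.9] -/
theorem isLimitOfCompactOpen_of_eq_subgroupOf {K M : Subgroup G} {S' : Subgroup ↥M} (hS' : S' = K.subgroupOf M)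
    (hK : IsLimitOfCompactOpen ↥K) (hM : IsClosed (M : Set G)) : IsLimitOfCompactOpen ↥S' := by
  subst hS'
  exact isLimitOfCompactOpen_subgroupOf hK hM

end Generic

/-! ## §2 The radicals of the Levi triples of `U(J')(F_v)` -/

section Local

variable {F : Type} [Field F] [NumberField F] (E : Type) [Field E] [NumberField E] [Algebra F E]
  (c : E ≃ₐ[F] E) (N : ℕ) (v : HeightOneSpectrum (𝓞 F)) (J' : Matrix (Fin N) (Fin N) (LocalRing E v))
  {α β : Type*} [LinearOrder α] [LinearOrder β] [Fintype β] (b : Fin N → α) (b' : Fin N → β)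

/-- **`N_S ∩ M_{S'} ∩ U` (inside `↥(M_{S'} ∩ U)`) is a limit of compact open subgroups**, for ANY form `J'` over `E_v = Π_{w∣v} E_w` and ANY
labellings `b` (of `S`) and `b'` (of `S'`): ★ `isLimitOfCompactOpen_comap_unipotentRadicalGL_local` + §1 + closedness of `M_{b'} ∩ U`.
[cite: BernsteinZelevinsky1977, §2.3] [cite: Casselman1995, Prop. 1.4.4] -/
theorem isLimitOfCompactOpen_subgroupOf_comap_unipotentRadicalGL_local :
    IsLimitOfCompactOpen ↥(((unipotentRadicalGL (LocalRing E v) b).comap (unitaryGroupOfForm (conjLocal E c v) J').subtype).subgroupOf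
      ((standardLeviGL (LocalRing E v) b').comap (unitaryGroupOfForm (conjLocal E c v) J').subtype)) :=
  isLimitOfCompactOpen_subgroupOf (isLimitOfCompactOpen_comap_unipotentRadicalGL_local E c N v J' b)
    (isClosed_comap_standardLeviGL (conjLocal E c v) b' J')

end Local

end Summit.HodgeConjecture.HodgeConjecture.Cruxes.H413.K2E3LimitCompactOpenSubgroupOf

end
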